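import Mathlib.Analysis.Complex.Schwarz
import Mathlib.Analysis.Calculus.Deriv.Star
import Mathlib.Analysis.Complex.UpperHalfPlane.Topology
import Literature.Analysis.Complex.RiemannMapping
import HarnessLib

/-!
# Symmetric Riemann maps; the conformal map of a domain with a free boundary segment onto the half-disc

Trunk support (complex analysis) for the boundary behaviour of Riemann maps at *free straight
boundary arcs*, used to discharge `Literature.Probability.RandomPlanarGeometry.IsStarHull.existsUnique_isRestrictionMap`
(`Literature/Probability/RandomPlanarGeometry/RestrictionHullsRiemannProofs.lean`: the
normalized conformal maps `Φ_A : ℍ ∖ A → ℍ` of Lawler–Schramm–Werner). Where the textbooks extend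
a Riemann map across a straight piece of the boundary by the Schwarz reflection principle (Lawler
(2005), §2.3 and proof of Prop. 3.36; Mathlib has no reflection principle, and the one proved in
`Literature/Probability/RandomPlanarGeometry/RestrictionHullsProofs.lean`,
`Literature.Probability.RandomPlanarGeometry.SchwarzReflection.differentiableOn_reflect`, starts from a map already known to extend
continuously and with real values to the boundary segment — for a Riemann map this boundary
behaviour is the very point to be established), we reflect the DOMAIN and use the uniqueness of
the based Riemann map instead (Conway VII.4.2): the Riemann map of a conjugation-symmetric
domain based at a real point commutes with conjugation, hence is real exactly on the real axis
and maps the upper half of the domain onto the upper half-disc; being holomorphic on the whole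
symmetric domain, it is holomorphic AT the real points of the domain.

* `Complex.HasSqrt.of_leftInvOn`, `Complex.HasSqrt.conj_preimage`, `Complex.HasSqrt.union`,
  `Convex.hasSqrt` — the square-root property (the hypothesis of Conway's Lemma VII.4.3,
  `Complex.HasSqrt` of `RiemannMapping.lean`) is transported along holomorphic changes of
  variables and along conjugation, glues over a preconnected overlap (two square roots of a
  zero-free function agree up to a constant sign there), and holds for convex open sets.
* `Complex.exists_bijOn_ball_symmetric` — the Riemann map `F` of a symmetric domain `E` based at
  a real point `x` and normalised by `F'(x) > 0` satisfies `F (conj z) = conj (F z)`: the map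
  `conj ∘ F ∘ conj ∘ F⁻¹` is a holomorphic self-map of the disc fixing `0` with derivative `1`,
  hence the identity (equality case of Schwarz's lemma, Mathlib
  `Complex.affine_of_mapsTo_ball_of_norm_dslope_eq_div`) — the uniqueness clause of Conway
  VII.4.2.
* `Complex.exists_bijOn_halfDisc` — for `U ⊆ ℍ` open, preconnected, with the square-root
  property, and `U ⊇ B(x, r) ∩ ℍ` (`x` real): a holomorphic bijection `F : U → 𝔻⁺ = 𝔻 ∩ ℍ` with
  holomorphic inverse, `F x = 0`, `F'(x) > 0` (so `F` is holomorphic at the boundary point `x`),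
  and `F⁻¹ → x` at `0` within `𝔻⁺`. (`F` is the symmetric Riemann map of
  `U ∪ B(x, r) ∪ conj (U ∪ B(x, r))`.)
* The (negative) Joukowski map `w ↦ -(w + w⁻¹)` — the conformal map of `𝔻⁺` onto `ℍ` with a
  pole at `0` (Lawler (2005), Example 3.38: `z + 1/z` maps `ℍ ∖ 𝔻̄` onto `ℍ`), written out as the
  lambda `fun w ↦ -(w + w⁻¹)` throughout (no definition is introduced):
  `Complex.bijOn_negJoukowski`, `Complex.differentiableOn_invFunOn_negJoukowski`,
  `Complex.tendsto_negJoukowski_nhdsNE_zero`, `Complex.tendsto_zero_of_tendsto_negJoukowski`.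

Everything in this file is proved; the file declares theorems only. As in `RiemannMapping.lean`,
declarations live in the `Complex` namespace deliberately.

## References

* J. B. Conway, *Functions of One Complex Variable I*, 2nd ed., GTM 11, Springer (1978), Ch. VII
  Thm. 4.2 (Riemann mapping theorem, with uniqueness under `f(a) = 0`, `f'(a) > 0`) and
  Lemma 4.3 [Conway1978].
* G. F. Lawler, *Conformally Invariant Processes in the Plane*, AMS (2005), §2.3 (extension of
  conformal maps across analytic boundary arcs by Schwarz reflection), §3.2 (compact hulls:
  "`F_K(z) = 1/f_K(1/z)` where `f_K` is the conformal transformation with `f_K(0) = 0`,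
  `f_K'(0) > 0`"), §3.4 Prop. 3.36 and Example 3.38 [Lawler2005].
-/

noncomputable section

open Filter Metric Set Topology Function
open scoped ComplexConjugate
open UpperHalfPlane (upperHalfPlaneSet isOpen_upperHalfPlaneSet)

namespace Complex

variable {U V W : Set ℂ}

/-! ### The square-root property: transport and gluing -/

/-- **Transport of the square-root property along a holomorphic change of variables**: if `V` has
the square-root property, `σ : V' → V` and `τ : V → V'` are holomorphic with `τ ∘ σ = id` on `V'`,
then `V'` has the square-root property (`h ∘ σ` is a square root of `g` when `h` is one of
`g ∘ τ`). [folklore] -/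
theorem HasSqrt.of_leftInvOn {V V' : Set ℂ} (hV : HasSqrt V) {σ τ : ℂ → ℂ}
    (hσ : DifferentiableOn ℂ σ V') (hσV : MapsTo σ V' V) (hτ : DifferentiableOn ℂ τ V)
    (hτV : MapsTo τ V V') (hinv : LeftInvOn τ σ V') : HasSqrt V' := by
  intro g hg hg0
  obtain ⟨h, hh, hsq⟩ := hV (g ∘ τ) (hg.comp hτ hτV) fun z hz ↦ hg0 _ (hτV hz)
  refine ⟨h ∘ σ, hh.comp hσ hσV, fun z hz ↦ ?_⟩
  rw [Function.comp_apply, hsq _ (hσV hz), Function.comp_apply, hinv hz]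

/-- `z ↦ conj (f (conj z))` is holomorphic on `conj ⁻¹' V` when `f` is holomorphic on the open set
`V`. [folklore] -/
theorem differentiableOn_conj_conj {f : ℂ → ℂ} (hV : IsOpen V) (hf : DifferentiableOn ℂ f V) :
    DifferentiableOn ℂ (fun z ↦ conj (f (conj z))) (conj ⁻¹' V) := by
  intro z hz
  have hd : DifferentiableAt ℂ f (conj z) := hf.differentiableAt (hV.mem_nhds hz)
  have := hd.conj_conj
  rw [conj_conj] at this
  exact this.differentiableWithinAt

/-- **The square-root property is invariant under complex conjugation** of the (open) set.
[folklore] -/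
theorem HasSqrt.conj_preimage (hV : HasSqrt V) (hVo : IsOpen V) : HasSqrt (conj ⁻¹' V) := by
  intro g hg hg0
  have hVo' : IsOpen (conj ⁻¹' V) := continuous_conj.isOpen_preimage _ hVo
  have hg' : DifferentiableOn ℂ (fun z ↦ conj (g (conj z))) V := by
    have := differentiableOn_conj_conj hVo' hg
    simpa only [preimage_preimage, conj_conj, preimage_id'] using this
  obtain ⟨h, hh, hsq⟩ := hV (fun z ↦ conj (g (conj z))) hg' (fun z hz ↦ by
    rw [map_ne_zero_iff _ (RingHom.injective _)]
    exact hg0 _ (show conj (conj z) ∈ V by rwa [conj_conj]))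
  refine ⟨fun z ↦ conj (h (conj z)), differentiableOn_conj_conj hVo hh, fun z hz ↦ ?_⟩
  rw [← map_pow, hsq _ hz, conj_conj, conj_conj]

/-- **Gluing square roots**: if the open sets `V`, `W` have the square-root property and `V ∩ W`
is preconnected, then `V ∪ W` has the square-root property (two square roots of the same
zero-free function on the preconnected overlap agree up to a sign). [folklore] -/
theorem HasSqrt.union (hV : HasSqrt V) (hW : HasSqrt W) (hVo : IsOpen V) (hWo : IsOpen W)
    (hVW : IsPreconnected (V ∩ W)) : HasSqrt (V ∪ W) := by
  classical
  intro g hg hg0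
  obtain ⟨h₁, hh₁, hsq₁⟩ := hV g (hg.mono subset_union_left) fun z hz ↦ hg0 z (Or.inl hz)
  obtain ⟨h₂, hh₂, hsq₂⟩ := hW g (hg.mono subset_union_right) fun z hz ↦ hg0 z (Or.inr hz)
  have h₂0 : ∀ z ∈ W, h₂ z ≠ 0 := fun z hz h0 ↦ hg0 z (Or.inr hz) (by
    rw [← hsq₂ z hz, h0]; ring)
  have hratio : ∀ z ∈ V ∩ W, h₁ z / h₂ z = 1 ∨ h₁ z / h₂ z = -1 := fun z hz ↦ by
    have h : (h₁ z / h₂ z) ^ 2 = 1 := by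
      rw [div_pow, hsq₁ z hz.1, hsq₂ z hz.2, div_self (hg0 z (Or.inr hz.2))]
    exact sq_eq_one_iff.1 h
  -- on the overlap `h₁ = s h₂` with a constant sign `s`
  obtain ⟨s, hs1, hs⟩ : ∃ s : ℂ, s ^ 2 = 1 ∧ ∀ z ∈ V ∩ W, h₁ z = s * h₂ z := by
    have hcont : ContinuousOn (fun z ↦ (h₁ z / h₂ z).re) (V ∩ W) :=
      continuous_re.comp_continuousOn ((hh₁.continuousOn.mono inter_subset_left).div
        (hh₂.continuousOn.mono inter_subset_right) fun z hz ↦ h₂0 z hz.2)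
    have hne0 : ∀ z ∈ V ∩ W, (h₁ z / h₂ z).re ≠ 0 := by
      intro z hz
      rcases hratio z hz with h | h <;> simp [h]
    rcases hVW.mapsTo_Ioi_or_Iio hcont hne0 with hpos | hneg
    · refine ⟨1, one_pow _, fun z hz ↦ ?_⟩
      have h0 : 0 < (h₁ z / h₂ z).re := hpos hz
      rcases hratio z hz with h | h
      · exact (div_eq_iff (h₂0 z hz.2)).1 h
      · exfalso
        rw [h] at h0
        norm_num at h0
    · refine ⟨-1, by norm_num, fun z hz ↦ ?_⟩
      have h0 : (h₁ z / h₂ z).re < 0 := hneg hz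
      rcases hratio z hz with h | h
      · exfalso
        rw [h] at h0
        norm_num at h0
      · exact (div_eq_iff (h₂0 z hz.2)).1 h
  refine ⟨V.piecewise h₁ (fun z ↦ s * h₂ z), ?_, fun z hz ↦ ?_⟩
  · rintro z (hzV | hzW)
    · have heq : V.piecewise h₁ (fun z ↦ s * h₂ z) =ᶠ[𝓝 z] h₁ := by
        filter_upwards [hVo.mem_nhds hzV] with w hw using piecewise_eq_of_mem _ _ _ hw
      exact ((hh₁.differentiableAt (hVo.mem_nhds hzV)).congr_of_eventuallyEq
        heq).differentiableWithinAt
    · by_cases hzV : z ∈ V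
      · have heq : V.piecewise h₁ (fun z ↦ s * h₂ z) =ᶠ[𝓝 z] h₁ := by
          filter_upwards [hVo.mem_nhds hzV] with w hw using piecewise_eq_of_mem _ _ _ hw
        exact ((hh₁.differentiableAt (hVo.mem_nhds hzV)).congr_of_eventuallyEq
          heq).differentiableWithinAt
      · have heq : V.piecewise h₁ (fun z ↦ s * h₂ z) =ᶠ[𝓝 z] fun w ↦ s * h₂ w := by
          filter_upwards [hWo.mem_nhds hzW] with w hw
          by_cases hwV : w ∈ V
          · rw [piecewise_eq_of_mem _ _ _ hwV, hs w ⟨hwV, hw⟩]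
          · rw [piecewise_eq_of_notMem _ _ _ hwV]
        exact ((((hh₂.differentiableAt (hWo.mem_nhds hzW)).const_mul s)).congr_of_eventuallyEq
          heq).differentiableWithinAt
  · by_cases hzV : z ∈ V
    · rw [piecewise_eq_of_mem _ _ _ hzV, hsq₁ z hzV]
    · have hzW : z ∈ W := hz.resolve_left hzV
      rw [piecewise_eq_of_notMem _ _ _ hzV, mul_pow, hs1, one_mul, hsq₂ z hzW]

/-- **Convex open sets have the square-root property** (they are simply connected, being
contractible). [folklore] -/
theorem _root_.Convex.hasSqrt (hc : Convex ℝ U) (hU : IsOpen U) (hne : U.Nonempty) :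
    HasSqrt U := by
  have : ContractibleSpace U := hc.contractibleSpace hne
  have hsc : IsSimplyConnected U := by
    change SimplyConnectedSpace U
    infer_instance
  exact hsc.hasSqrt hU

/-! ### Symmetric Riemann maps -/

/-- **The Riemann map of a symmetric domain based at a real point is symmetric.** Let `E ⊊ ℂ` be
open, connected, with the square-root property, invariant under complex conjugation, and let
`x ∈ E ∩ ℝ`. Then there is a holomorphic bijection `F : E → 𝔻` with `F x = 0`, `F'(x) > 0`,
zero-free derivative, holomorphic inverse, and `F (conj z) = conj (F z)` on `E`. Proof: take a
Riemann map `f` based at `x` (`Complex.exists_bijOn_ball_of_hasSqrt`, Conway VII.4.3) and rotate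
it so that `F'(x) > 0`; then `z ↦ conj (F (conj z))` composed with `F⁻¹` is a holomorphic self-map
of the disc fixing `0` with derivative `1`, hence the identity by the equality case of Schwarz's
lemma (Mathlib `Complex.affine_of_mapsTo_ball_of_norm_dslope_eq_div`). This is the uniqueness
part of the Riemann mapping theorem (Conway VII.4.2; Lawler (2005), Thm. 3.6) applied to the two
based maps `F` and `conj ∘ F ∘ conj`. [cite: Conway1978, Ch. VII Thm. 4.2 (uniqueness) and Lemma 4.3] -/
theorem exists_bijOn_ball_symmetric {E : Set ℂ} (hE : IsOpen E) (hEc : IsPreconnected E)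
    (hsq : HasSqrt E) (hE' : E ≠ univ) (hsymm : MapsTo conj E E) {x : ℝ} (hx : (x : ℂ) ∈ E) :
    ∃ F : ℂ → ℂ, DifferentiableOn ℂ F E ∧ BijOn F E (ball 0 1) ∧ F x = 0 ∧
      (∀ z ∈ E, deriv F z ≠ 0) ∧ DifferentiableOn ℂ (invFunOn F E) (ball 0 1) ∧
      (∃ c : ℝ, 0 < c ∧ HasDerivAt F c x) ∧ ∀ z ∈ E, F (conj z) = conj (F z) := by
  obtain ⟨f, hf, hbij, hf0, hf', -⟩ := exists_bijOn_ball_of_hasSqrt hE hEc hsq hE' hx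
  -- rotate so that the derivative at `x` is positive
  set d : ℂ := deriv f x with hd_def
  have hd : d ≠ 0 := hf' x hx
  have hdn : (0 : ℝ) < ‖d‖ := norm_pos_iff.2 hd
  set u : ℂ := conj d / ‖d‖ with hu_def
  have hu : ‖u‖ = 1 := by
    rw [hu_def, norm_div, norm_conj, Complex.norm_real, Real.norm_eq_abs, abs_of_pos hdn,
      div_self hdn.ne']
  have hu0 : u ≠ 0 := norm_ne_zero_iff.1 (by rw [hu]; exact one_ne_zero)
  have hud : u * d = (‖d‖ : ℂ) := by
    rw [hu_def, div_mul_eq_mul_div, conj_mul', div_eq_iff (ofReal_ne_zero.2 hdn.ne')]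
    ring
  set F : ℂ → ℂ := fun z ↦ u * f z with hF_def
  have hF : DifferentiableOn ℂ F E := hf.const_mul u
  have hFbij : BijOn F E (ball 0 1) := by
    refine ⟨fun z hz ↦ ?_, fun a ha b hb hab ↦ ?_, fun w hw ↦ ?_⟩
    · have := hbij.mapsTo hz
      rw [mem_ball_zero_iff] at this ⊢
      rwa [hF_def, norm_mul, hu, one_mul]
    · exact hbij.injOn ha hb (mul_left_cancel₀ hu0 hab)
    · have hw' : u⁻¹ * w ∈ ball (0 : ℂ) 1 := by
        rw [mem_ball_zero_iff] at hw ⊢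
        rwa [norm_mul, norm_inv, hu, inv_one, one_mul]
      obtain ⟨z, hz, hzw⟩ := hbij.surjOn hw'
      exact ⟨z, hz, by simp only [hF_def, hzw, mul_inv_cancel_left₀ hu0]⟩
  have hF0 : F x = 0 := by simp only [hF_def, hf0, mul_zero]
  have hFd : ∀ z ∈ E, HasDerivAt F (u * deriv f z) z := fun z hz ↦
    ((hf.differentiableAt (hE.mem_nhds hz)).hasDerivAt).const_mul u
  have hF' : ∀ z ∈ E, deriv F z ≠ 0 := fun z hz ↦ by
    rw [(hFd z hz).deriv]
    exact mul_ne_zero hu0 (hf' z hz)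
  have hFx : HasDerivAt F ((‖d‖ : ℝ) : ℂ) x := by
    have := hFd x hx
    rwa [hud] at this
  have hFinv : DifferentiableOn ℂ (invFunOn F E) (ball 0 1) := by
    rw [← hFbij.image_eq]
    exact differentiableOn_invFunOn_image hE hF hFbij.injOn hF'
  refine ⟨F, hF, hFbij, hF0, hF', hFinv, ⟨‖d‖, hdn, hFx⟩, ?_⟩
  -- symmetry: `S = conj ∘ F ∘ conj ∘ F⁻¹` is a self-map of the disc fixing `0` with `S'(0) = 1`
  set Fc : ℂ → ℂ := fun z ↦ conj (F (conj z)) with hFc_def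
  have hFc : DifferentiableOn ℂ Fc E :=
    (differentiableOn_conj_conj hE hF).mono fun z hz ↦ hsymm hz
  have hFc_maps : MapsTo Fc E (ball 0 1) := fun z hz ↦ by
    have := hFbij.mapsTo (hsymm hz)
    rw [mem_ball_zero_iff] at this ⊢
    rwa [hFc_def, norm_conj]
  set Fi : ℂ → ℂ := invFunOn F E with hFi_def
  have hInv : InvOn Fi F E (ball 0 1) := hFbij.invOn_invFunOn
  have hFi_maps : MapsTo Fi (ball 0 1) E := hFbij.surjOn.mapsTo_invFunOn
  have hFi0 : Fi 0 = x := by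
    have := hInv.1 hx
    rwa [hF0] at this
  have hxconj : conj (x : ℂ) = x := conj_ofReal x
  have hFcx : HasDerivAt Fc ((‖d‖ : ℝ) : ℂ) x := by
    have h := hFx.conj_conj
    rw [hxconj, conj_ofReal] at h
    exact h
  have hFi_d : HasDerivAt Fi (((‖d‖ : ℝ) : ℂ))⁻¹ 0 := by
    have h := (hasStrictDerivAt_invFunOn hE hF hFbij.injOn hF' hx).hasDerivAt
    rwa [hF0, hFx.deriv] at h
  set S : ℂ → ℂ := Fc ∘ Fi with hS_def
  have hS : DifferentiableOn ℂ S (ball 0 1) := hFc.comp hFinv hFi_maps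
  have hS0 : S 0 = 0 := by
    simp only [hS_def, Function.comp_apply, hFi0, hFc_def, hxconj, hF0, map_zero]
  have hSmaps : MapsTo S (ball 0 1) (closedBall (S 0) 1) := by
    rw [hS0]
    exact fun w hw ↦ ball_subset_closedBall (hFc_maps (hFi_maps hw))
  have hSd : HasDerivAt S 1 0 := by
    have h1 : HasDerivAt Fc ((‖d‖ : ℝ) : ℂ) (Fi 0) := by rwa [hFi0]
    have h := h1.comp 0 hFi_d
    rwa [mul_inv_cancel₀ (ofReal_ne_zero.2 hdn.ne')] at h
  have hslope : ‖dslope S 0 0‖ = 1 / 1 := by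
    rw [dslope_same, hSd.deriv, norm_one, div_one]
  have hSid : EqOn S (fun w ↦ w) (ball 0 1) := by
    intro w hw
    have h := affine_of_mapsTo_ball_of_norm_dslope_eq_div hS hSmaps (mem_ball_self one_pos)
      hslope hw
    rw [h, dslope_same, hSd.deriv, hS0]
    simp
  intro z hz
  have h1 : Fc (Fi (F z)) = F z := hSid (hFbij.mapsTo hz)
  rw [hInv.1 hz] at h1
  -- `h1 : conj (F (conj z)) = F z`
  have h2 := congrArg conj h1
  simp only [hFc_def, conj_conj] at h2
  exact h2


/-! ### The symmetric Riemann map of a half-neighbourhood onto the half-disc -/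

/-- The reflection of a disc centred on the real axis is itself. [folklore] -/
theorem conj_preimage_ball_ofReal (x r : ℝ) : conj ⁻¹' ball (x : ℂ) r = ball (x : ℂ) r := by
  ext z
  simp only [mem_preimage, Metric.mem_ball]
  rw [← conj_ofReal x, dist_conj_conj, conj_ofReal]

/-- **Conformal map of a domain in `ℍ` with a free boundary segment onto the half-disc.** Let
`U ⊆ ℍ` be open and connected with the square-root property (e.g. simply connected), containing
the half-disc `B(x, r) ∩ ℍ` above a real point `x`. Then there is a holomorphic bijection `F` of
`U` onto the upper half-disc `𝔻⁺ = 𝔻 ∩ ℍ` with holomorphic inverse, which is holomorphic AT the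
boundary point `x` with `F x = 0`, `F'(x) > 0`, and whose inverse tends to `x` at `0`. It is the
restriction of the symmetric Riemann map (`Complex.exists_bijOn_ball_symmetric`) of the
symmetric domain `U ∪ B(x, r) ∪ conj (U ∪ B(x, r))`, which has the square-root property by
gluing (`Complex.HasSqrt.union`) and maps `U` onto `𝔻⁺` because it is real exactly on the real
axis. This replaces the Schwarz reflection principle for the boundary behaviour of Riemann maps at
free analytic boundary arcs (Lawler (2005), §2.3 p. 48 and proof of Prop. 3.36; Conway VII.4.2).
[cite: Conway1978, Ch. VII Thm. 4.2 (uniqueness) and Lemma 4.3] -/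
theorem exists_bijOn_halfDisc (hU : IsOpen U) (hUc : IsPreconnected U) (hsq : HasSqrt U)
    (hUH : U ⊆ upperHalfPlaneSet) {x r : ℝ} (hr : 0 < r)
    (hB : ball (x : ℂ) r ∩ upperHalfPlaneSet ⊆ U) :
    ∃ F : ℂ → ℂ, DifferentiableOn ℂ F U ∧ BijOn F U (ball 0 1 ∩ upperHalfPlaneSet) ∧
      DifferentiableOn ℂ (invFunOn F U) (ball 0 1 ∩ upperHalfPlaneSet) ∧ F x = 0 ∧
      (∃ c : ℝ, 0 < c ∧ HasDerivAt F c x) ∧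
      Tendsto (invFunOn F U) (𝓝[ball 0 1 ∩ upperHalfPlaneSet] 0) (𝓝 x) := by
  set B : Set ℂ := ball (x : ℂ) r with hB_def
  set V₁ : Set ℂ := U ∪ B with hV₁
  set V₂ : Set ℂ := conj ⁻¹' V₁ with hV₂
  set E : Set ℂ := V₁ ∪ V₂ with hE_def
  have hBc : conj ⁻¹' B = B := conj_preimage_ball_ofReal x r
  have hxB : (x : ℂ) ∈ B := mem_ball_self hr
  have hV₁o : IsOpen V₁ := hU.union isOpen_ball
  have hV₂o : IsOpen V₂ := continuous_conj.isOpen_preimage _ hV₁o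
  have hEo : IsOpen E := hV₁o.union hV₂o
  have hUB : U ∩ B = B ∩ upperHalfPlaneSet := by
    apply Subset.antisymm
    · rintro z ⟨hzU, hzB⟩
      exact ⟨hzB, hUH hzU⟩
    · rintro z ⟨hzB, hzH⟩
      exact ⟨hB ⟨hzB, hzH⟩, hzB⟩
  have hBH : IsPreconnected (B ∩ upperHalfPlaneSet) :=
    ((convex_ball _ _).inter (convex_halfSpace_im_gt 0)).isPreconnected
  -- the square-root property of `E`, by gluing
  have hsqV₁ : HasSqrt V₁ :=
    hsq.union ((convex_ball _ _).hasSqrt isOpen_ball ⟨_, hxB⟩) hU isOpen_ball (by rwa [hUB])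
  have hsqV₂ : HasSqrt V₂ := hsqV₁.conj_preimage hV₁o
  have hV₁₂ : V₁ ∩ V₂ = B := by
    apply Subset.antisymm
    · rintro z ⟨hz₁, hz₂⟩
      by_contra hzB
      have hzU : z ∈ U := hz₁.resolve_right hzB
      have hz₂' : conj z ∈ U := by
        rcases hz₂ with h | h
        · exact h
        · exact absurd (show z ∈ B by rwa [← hBc]) hzB
      have h1 : 0 < z.im := hUH hzU
      have h2 : 0 < (conj z).im := hUH hz₂'
      rw [conj_im] at h2
      linarith
    · intro z hz
      exact ⟨Or.inr hz, show conj z ∈ V₁ from Or.inr (by rw [← hBc] at hz; exact hz)⟩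
  have hsqE : HasSqrt E := hsqV₁.union hsqV₂ hV₁o hV₂o (by
    rw [hV₁₂]; exact (convex_ball _ _).isPreconnected)
  -- connectedness, symmetry, properness of `E`
  have hpU : (x : ℂ) + (r / 2 : ℝ) * I ∈ B ∩ upperHalfPlaneSet := by
    constructor
    · rw [hB_def, Metric.mem_ball, dist_eq_norm, add_sub_cancel_left, norm_mul, norm_real, norm_I,
        mul_one, Real.norm_eq_abs, abs_of_pos (by positivity)]
      linarith
    · show 0 < ((x : ℂ) + (r / 2 : ℝ) * I).im
      simp [hr]
  have hV₁c : IsPreconnected V₁ :=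
    hUc.union' ⟨_, hB hpU, hpU.1⟩ (convex_ball _ _).isPreconnected
  have hV₂eq : V₂ = conj '' V₁ := by
    rw [hV₂, image_eq_preimage_of_inverse (f := (conj : ℂ → ℂ)) (g := (conj : ℂ → ℂ))
      conj_conj conj_conj]
  have hV₂c : IsPreconnected V₂ := by
    rw [hV₂eq]
    exact hV₁c.image _ continuous_conj.continuousOn
  have hxV₁ : (x : ℂ) ∈ V₁ := Or.inr hxB
  have hxV₂ : (x : ℂ) ∈ V₂ := show conj (x : ℂ) ∈ V₁ by rwa [conj_ofReal]
  have hEc : IsPreconnected E := hV₁c.union _ hxV₁ hxV₂ hV₂c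
  have hxE : (x : ℂ) ∈ E := Or.inl hxV₁
  have hsymm : MapsTo conj E E := by
    rintro z (hz | hz)
    · exact Or.inr (show conj (conj z) ∈ V₁ by rwa [conj_conj])
    · exact Or.inl hz
  have hV₁real : ∀ z ∈ V₁, z.im = 0 → z ∈ B := by
    rintro z (hz | hz) hzim
    · exact absurd hzim (hUH hz).ne'
    · exact hz
  have hE' : E ≠ univ := by
    intro h
    have hmem : ((x + r : ℝ) : ℂ) ∈ E := h ▸ mem_univ _
    have hnotB : ((x + r : ℝ) : ℂ) ∉ B := by
      rw [hB_def, Metric.mem_ball, dist_eq_norm, ← ofReal_sub, norm_real, Real.norm_eq_abs]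
      simp [abs_of_pos hr]
    rcases hmem with hz | hz
    · exact hnotB (hV₁real _ hz (ofReal_im _))
    · have hz' : ((x + r : ℝ) : ℂ) ∈ V₁ := by
        have := hz
        rwa [hV₂, mem_preimage, conj_ofReal] at this
      exact hnotB (hV₁real _ hz' (ofReal_im _))
  -- the symmetric Riemann map of `E` based at `x`
  obtain ⟨F, hF, hbij, hF0, hF', hFinv, ⟨c, hc, hFd⟩, hFsymm⟩ :=
    exists_bijOn_ball_symmetric hEo hEc hsqE hE' hsymm hxE
  -- `F` is real exactly on the real axis
  have hreal : ∀ z ∈ E, (F z).im = 0 → z.im = 0 := by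
    intro z hz hFz
    have h1 : F (conj z) = F z := by rw [hFsymm z hz, conj_eq_iff_im.2 hFz]
    have h2 : conj z = z := hbij.injOn (hsymm hz) hz h1
    exact conj_eq_iff_im.1 h2
  have hEH : E ∩ upperHalfPlaneSet ⊆ U := by
    rintro z ⟨hzE, hzH⟩
    rcases hzE with (hz | hz) | hz
    · exact hz
    · exact hB ⟨hz, hzH⟩
    · rcases hz with hz | hz
      · have h1 : 0 < (conj z).im := hUH hz
        have h2 : 0 < z.im := hzH
        rw [conj_im] at h1
        exact absurd h2 (by linarith)
      · have hz' : z ∈ B := by rw [← hBc]; exact hz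
        exact hB ⟨hz', hzH⟩
  have hUE : U ⊆ E := fun z hz ↦ Or.inl (Or.inl hz)
  have hne : ∀ z ∈ U, (F z).im ≠ 0 := fun z hz h ↦ (hUH hz).ne' (hreal z (hUE hz) h)
  -- a witness of positivity just above `x`, from `F'(x) > 0`
  have hwit : ∃ z ∈ U, 0 < (F z).im := by
    have h1 : Tendsto (fun t : ℂ ↦ t⁻¹ • (F (x + t) - F x)) (𝓝[≠] 0) (𝓝 (c : ℂ)) :=
      hFd.tendsto_slope_zero
    have h2 : Tendsto (fun s : ℝ ↦ (s : ℂ) * I) (𝓝[>] 0) (𝓝[≠] 0) := by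
      refine tendsto_nhdsWithin_of_tendsto_nhds_of_eventually_within _ ?_ ?_
      · have : Continuous fun s : ℝ ↦ (s : ℂ) * I := by fun_prop
        simpa using (this.tendsto 0).mono_left nhdsWithin_le_nhds
      · filter_upwards [self_mem_nhdsWithin] with s hs
        exact mul_ne_zero (ofReal_ne_zero.2 (ne_of_gt hs)) I_ne_zero
    have h3 := (continuous_re.tendsto _).comp (h1.comp h2)
    simp only [ofReal_re] at h3
    have h4 : ∀ᶠ s : ℝ in 𝓝[>] 0, 0 < (((s : ℂ) * I)⁻¹ • (F (x + (s : ℂ) * I) - F x)).re :=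
      h3.eventually (lt_mem_nhds hc)
    have h5 : ∀ᶠ s : ℝ in 𝓝[>] 0, s < r := by
      have : Iio r ∈ 𝓝 (0 : ℝ) := Iio_mem_nhds hr
      exact mem_nhdsWithin_of_mem_nhds this
    obtain ⟨s, ⟨h4s, h5s⟩, hs0⟩ := ((h4.and h5).and self_mem_nhdsWithin).exists
    have hs0' : (0 : ℝ) < s := hs0
    have hzB : (x : ℂ) + (s : ℂ) * I ∈ B ∩ upperHalfPlaneSet := by
      constructor
      · rw [hB_def, Metric.mem_ball, dist_eq_norm, add_sub_cancel_left, norm_mul, norm_real,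
          norm_I, mul_one, Real.norm_eq_abs, abs_of_pos hs0']
        exact h5s
      · show 0 < ((x : ℂ) + (s : ℂ) * I).im
        simp [hs0']
    refine ⟨_, hB hzB, ?_⟩
    rw [hF0, sub_zero, smul_eq_mul] at h4s
    have key : (((s : ℂ) * I)⁻¹ * F (x + (s : ℂ) * I)).re = (F (x + (s : ℂ) * I)).im / s := by
      rw [mul_inv, Complex.inv_I, mul_re]
      simp [Complex.inv_re, Complex.inv_im, div_eq_inv_mul]
      left
      field_simp
    rw [key] at h4s
    exact (div_pos_iff_of_pos_right hs0').1 h4s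
  have hpos : ∀ z ∈ U, 0 < (F z).im := fun z hz ↦
    hUc.lt_of_ne (continuous_im.comp_continuousOn (hF.mono hUE).continuousOn) hne hwit hz
  -- points of `E` mapped into the upper half-plane lie in `U`
  have hback : ∀ z ∈ E, 0 < (F z).im → z ∈ U := by
    intro z hz hFz
    rcases lt_trichotomy z.im 0 with him | him | him
    · have hcz : conj z ∈ E ∩ upperHalfPlaneSet :=
        ⟨hsymm hz, show 0 < (conj z).im by rw [conj_im]; linarith⟩
      have h1 := hpos _ (hEH hcz)
      rw [hFsymm z hz, conj_im] at h1
      linarith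
    · have h1 : F z = conj (F z) := by
        conv_lhs => rw [← conj_eq_iff_im.2 him]
        exact hFsymm z hz
      have h2 : (F z).im = 0 := conj_eq_iff_im.1 h1.symm
      linarith
    · exact hEH ⟨hz, him⟩
  have hbijU : BijOn F U (ball 0 1 ∩ upperHalfPlaneSet) := by
    refine ⟨fun z hz ↦ ⟨hbij.mapsTo (hUE hz), hpos z hz⟩, hbij.injOn.mono hUE, fun w hw ↦ ?_⟩
    obtain ⟨z, hz, rfl⟩ := hbij.surjOn hw.1
    exact ⟨z, hback z hz hw.2, rfl⟩
  -- the two inverse functions agree on the half-disc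
  have hinvEq : EqOn (invFunOn F U) (invFunOn F E) (ball 0 1 ∩ upperHalfPlaneSet) := by
    intro w hw
    have hU' : ∃ a ∈ U, F a = w := hbijU.surjOn hw
    have hE'' : ∃ a ∈ E, F a = w := hbij.surjOn hw.1
    apply hbij.injOn (hUE (invFunOn_mem hU')) (invFunOn_mem hE'')
    rw [invFunOn_eq hU', invFunOn_eq hE'']
  have hinvU : DifferentiableOn ℂ (invFunOn F U) (ball 0 1 ∩ upperHalfPlaneSet) :=
    (hFinv.mono inter_subset_left).congr hinvEq
  have hinv0 : invFunOn F E 0 = x := by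
    have := hbij.invOn_invFunOn.1 hxE
    rwa [hF0] at this
  have htend : Tendsto (invFunOn F U) (𝓝[ball 0 1 ∩ upperHalfPlaneSet] 0) (𝓝 x) := by
    have h1 : ContinuousAt (invFunOn F E) 0 :=
      hFinv.continuousOn.continuousAt (isOpen_ball.mem_nhds (mem_ball_self one_pos))
    have h2 : Tendsto (invFunOn F E) (𝓝[ball 0 1 ∩ upperHalfPlaneSet] 0) (𝓝 x) := by
      rw [← hinv0]
      exact h1.tendsto.mono_left nhdsWithin_le_nhds
    exact h2.congr' (eventuallyEq_nhdsWithin_of_eqOn hinvEq).symm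
  exact ⟨F, hF.mono hUE, hbijU, hinvU, hF0, ⟨c, hc, hFd⟩, htend⟩


/-! ### The half-disc and the half-plane: the map `w ↦ -(w + 1/w)` -/

/-- The imaginary part of the (negative) **Joukowski map** `J(w) = -(w + w⁻¹)` (a conformal
equivalence of the upper half-disc `𝔻 ∩ ℍ` onto the upper half-plane `ℍ` with `0 ↦ ∞`; Lawler
(2005), Example 3.38: `z + 1/z` maps `ℍ ∖ 𝔻̄` onto `ℍ`, composed here with `z ↦ -1/z`):
`Im J(w) = Im w · (|w|⁻² - 1)`. [folklore] -/
theorem negJoukowski_im (w : ℂ) : (-(w + w⁻¹)).im = w.im * ((normSq w)⁻¹ - 1) := by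
  rw [neg_im, add_im, inv_im]
  ring

/-- On the punctured unit disc the factor `|w|⁻² - 1` is positive. [folklore] -/
theorem inv_normSq_sub_one_pos {w : ℂ} (hw : ‖w‖ < 1) (hw0 : w ≠ 0) : 0 < (normSq w)⁻¹ - 1 := by
  have h1 : 0 < normSq w := normSq_pos.2 hw0
  have h2 : normSq w < 1 := by
    rw [normSq_eq_norm_sq]
    nlinarith [norm_nonneg w]
  have : 1 < (normSq w)⁻¹ := by rwa [lt_inv_comm₀ one_pos h1, inv_one]
  linarith

/-- The Joukowski map sends the upper half-disc into the upper half-plane. [folklore] -/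
theorem mapsTo_negJoukowski :
    MapsTo (fun w : ℂ ↦ -(w + w⁻¹)) (ball 0 1 ∩ upperHalfPlaneSet) upperHalfPlaneSet := by
  rintro w ⟨hw, hwH⟩
  have hwH' : 0 < w.im := hwH
  have hw0 : w ≠ 0 := by rintro rfl; simp at hwH'
  show 0 < (-(w + w⁻¹)).im
  rw [negJoukowski_im]
  exact mul_pos hwH' (inv_normSq_sub_one_pos (mem_ball_zero_iff.1 hw) hw0)

/-- The Joukowski map is injective on the punctured unit disc: `J a = J b` forces `a = b` or
`a b = 1`. [folklore] -/
theorem injOn_negJoukowski : InjOn (fun w : ℂ ↦ -(w + w⁻¹)) (ball 0 1 \ {0}) := by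
  rintro a ⟨ha, ha0⟩ b ⟨hb, hb0⟩ hab
  rw [mem_ball_zero_iff] at ha hb
  have ha0 : a ≠ 0 := ha0
  have hb0 : b ≠ 0 := hb0
  have hab' : -(a + a⁻¹) = -(b + b⁻¹) := hab
  have h1 : a + a⁻¹ = b + b⁻¹ := neg_inj.1 hab'
  have h2 : (a - b) * (a * b - 1) = 0 := by
    have h3 : (a - b) * (a * b - 1) = ((a + a⁻¹) - (b + b⁻¹)) * (a * b) := by
      field_simp
      ring
    rw [h3, h1, sub_self, zero_mul]
  rcases mul_eq_zero.1 h2 with h | h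
  · exact sub_eq_zero.1 h
  · exfalso
    have h4 : ‖a * b‖ < 1 := by
      rw [norm_mul]
      nlinarith [norm_nonneg a, norm_nonneg b]
    rw [sub_eq_zero.1 h, norm_one] at h4
    exact lt_irrefl _ h4

/-- The Joukowski map sends the upper half-disc ONTO the upper half-plane: for `ζ ∈ ℍ` the two
roots of `w² + ζ w + 1` have product `1`, none lies on the unit circle (there `J` is real), and the
one inside the disc has positive imaginary part. [folklore] -/
theorem surjOn_negJoukowski :
    SurjOn (fun w : ℂ ↦ -(w + w⁻¹)) (ball 0 1 ∩ upperHalfPlaneSet) upperHalfPlaneSet := by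
  intro ζ hζ
  have hζ' : 0 < ζ.im := hζ
  -- a square root of the discriminant and the two roots
  obtain ⟨s, hs⟩ : ∃ s : ℂ, s ^ 2 = ζ ^ 2 - 4 := ⟨(ζ ^ 2 - 4) ^ (1 / 2 : ℂ), by
    rw [← cpow_nat_mul]; norm_num⟩
  set w₁ : ℂ := (-ζ + s) / 2 with hw₁
  set w₂ : ℂ := (-ζ - s) / 2 with hw₂
  have hprod : w₁ * w₂ = 1 := by
    rw [hw₁, hw₂]
    linear_combination (-1 / 4 : ℂ) * hs
  have hsum : w₁ + w₂ = -ζ := by rw [hw₁, hw₂]; ring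
  have hw₁0 : w₁ ≠ 0 := left_ne_zero_of_mul_eq_one hprod
  have hw₂0 : w₂ ≠ 0 := right_ne_zero_of_mul_eq_one hprod
  have hw₂inv : w₁⁻¹ = w₂ := (eq_inv_of_mul_eq_one_right hprod).symm
  have hw₁inv : w₂⁻¹ = w₁ := (eq_inv_of_mul_eq_one_left hprod).symm
  have hJ₁ : -(w₁ + w₁⁻¹) = ζ := by
    rw [hw₂inv, hsum, neg_neg]
  have hJ₂ : -(w₂ + w₂⁻¹) = ζ := by
    rw [hw₁inv, add_comm, hsum, neg_neg]
  -- a root `w` in the punctured disc with `J w = ζ`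
  obtain ⟨w, hw, hw0, hJ⟩ : ∃ w : ℂ, ‖w‖ < 1 ∧ w ≠ 0 ∧ -(w + w⁻¹) = ζ := by
    rcases lt_trichotomy ‖w₁‖ 1 with h | h | h
    · exact ⟨w₁, h, hw₁0, hJ₁⟩
    · exfalso
      have hinv : w₁⁻¹ = conj w₁ := by
        rw [inv_def, normSq_eq_norm_sq, h]
        simp
      have him : (-(w₁ + w₁⁻¹)).im = 0 := by
        rw [hinv, neg_im, add_im, conj_im]
        ring
      rw [hJ₁] at him
      exact hζ'.ne' him
    · refine ⟨w₂, ?_, hw₂0, hJ₂⟩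
      rw [← hw₂inv, norm_inv]
      exact inv_lt_one_of_one_lt₀ h
  refine ⟨w, ⟨mem_ball_zero_iff.2 hw, ?_⟩, hJ⟩
  show 0 < w.im
  have h1 : 0 < w.im * ((normSq w)⁻¹ - 1) := by
    rw [← negJoukowski_im, hJ]
    exact hζ'
  exact pos_of_mul_pos_left h1 (inv_normSq_sub_one_pos hw hw0).le

/-- The Joukowski map is a bijection of the upper half-disc onto the upper half-plane. [folklore] -/
theorem bijOn_negJoukowski :
    BijOn (fun w : ℂ ↦ -(w + w⁻¹)) (ball 0 1 ∩ upperHalfPlaneSet) upperHalfPlaneSet := by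
  refine ⟨mapsTo_negJoukowski, injOn_negJoukowski.mono ?_, surjOn_negJoukowski⟩
  rintro w ⟨hw, hwH⟩
  refine ⟨hw, fun h ↦ ?_⟩
  have h0 : (0 : ℝ) < w.im := hwH
  rw [show w = 0 from h] at h0
  simp at h0

/-- The derivative of the Joukowski map: `J'(w) = w⁻² - 1` (`w ≠ 0`). [folklore] -/
theorem hasDerivAt_negJoukowski {w : ℂ} (hw : w ≠ 0) :
    HasDerivAt (fun w : ℂ ↦ -(w + w⁻¹)) ((w ^ 2)⁻¹ - 1) w := by
  have h : HasDerivAt (fun y : ℂ ↦ -(y + y⁻¹)) (-(1 + -(w ^ 2)⁻¹)) w :=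
    ((hasDerivAt_id' w).add (hasDerivAt_inv hw)).neg
  have h' : (-(1 + -(w ^ 2)⁻¹) : ℂ) = (w ^ 2)⁻¹ - 1 := by ring
  rw [h'] at h
  exact h

/-- The Joukowski map is holomorphic off `0`. [folklore] -/
theorem differentiableOn_negJoukowski :
    DifferentiableOn ℂ (fun w : ℂ ↦ -(w + w⁻¹)) {w | w ≠ 0} :=
  fun _ hw ↦ (hasDerivAt_negJoukowski hw).differentiableAt.differentiableWithinAt

/-- The derivative of the Joukowski map does not vanish on the punctured unit disc. [folklore] -/
theorem deriv_negJoukowski_ne_zero {w : ℂ} (hw : ‖w‖ < 1) (hw0 : w ≠ 0) :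
    deriv (fun w : ℂ ↦ -(w + w⁻¹)) w ≠ 0 := by
  rw [(hasDerivAt_negJoukowski hw0).deriv, sub_ne_zero]
  intro h
  have h1 : ‖w ^ 2‖ < 1 := by
    rw [norm_pow]
    nlinarith [norm_nonneg w]
  have h2 : w ^ 2 = 1 := by rw [← inv_inv (w ^ 2), h, inv_one]
  rw [h2, norm_one] at h1
  exact lt_irrefl _ h1

/-- The upper half-disc is open. [folklore] -/
theorem isOpen_ball_inter_upperHalfPlaneSet : IsOpen (ball (0 : ℂ) 1 ∩ upperHalfPlaneSet) :=
  isOpen_ball.inter isOpen_upperHalfPlaneSet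

/-- The inverse of the Joukowski map is holomorphic on the upper half-plane (inverse function
theorem, `Complex.differentiableOn_invFunOn_image`). [folklore] -/
theorem differentiableOn_invFunOn_negJoukowski :
    DifferentiableOn ℂ (invFunOn (fun w : ℂ ↦ -(w + w⁻¹)) (ball 0 1 ∩ upperHalfPlaneSet))
      upperHalfPlaneSet := by
  have h0 : ∀ w ∈ ball (0 : ℂ) 1 ∩ upperHalfPlaneSet, w ≠ 0 := by
    rintro w ⟨-, hw⟩ rfl
    exact absurd hw (by simp [upperHalfPlaneSet])
  have h := differentiableOn_invFunOn_image isOpen_ball_inter_upperHalfPlaneSet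
    (differentiableOn_negJoukowski.mono h0) bijOn_negJoukowski.injOn (fun w hw ↦
      deriv_negJoukowski_ne_zero (mem_ball_zero_iff.1 hw.1) (h0 w hw))
  rwa [bijOn_negJoukowski.image_eq] at h

/-- `|J(w)| ≤ |w| + |w|⁻¹`. [folklore] -/
theorem norm_negJoukowski_le (w : ℂ) : ‖-(w + w⁻¹)‖ ≤ ‖w‖ + ‖w‖⁻¹ := by
  rw [norm_neg, ← norm_inv]
  exact norm_add_le _ _

/-- `|w|⁻¹ - |w| ≤ |J(w)|`. [folklore] -/
theorem inv_norm_sub_norm_le_negJoukowski (w : ℂ) : ‖w‖⁻¹ - ‖w‖ ≤ ‖-(w + w⁻¹)‖ := by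
  rw [norm_neg, ← norm_inv]
  have := norm_sub_norm_le w⁻¹ (-w)
  rw [norm_neg, sub_neg_eq_add, add_comm] at this
  linarith

/-- **The Joukowski map has a pole at `0`**: `J(w) → ∞` as `w → 0`, `w ≠ 0`. [folklore] -/
theorem tendsto_negJoukowski_nhdsNE_zero :
    Tendsto (fun w : ℂ ↦ -(w + w⁻¹)) (𝓝[≠] 0) (cocompact ℂ) := by
  rw [← cobounded_eq_cocompact, ← tendsto_norm_atTop_iff_cobounded]
  have h1 : Tendsto (fun w : ℂ ↦ ‖w⁻¹‖ - ‖w‖) (𝓝[≠] 0) atTop := by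
    refine tendsto_atTop_add_right_of_le' _ (-1) tendsto_norm_inv_nhdsNE_zero_atTop ?_
    have : ∀ᶠ w : ℂ in 𝓝[≠] 0, ‖w‖ < 1 := by
      have h : ball (0 : ℂ) 1 ∈ 𝓝 (0 : ℂ) := ball_mem_nhds _ one_pos
      filter_upwards [mem_nhdsWithin_of_mem_nhds h] with w hw using mem_ball_zero_iff.1 hw
    filter_upwards [this] with w hw
    linarith
  refine tendsto_atTop_mono (fun w ↦ ?_) h1
  rw [norm_inv]
  exact inv_norm_sub_norm_le_negJoukowski w

/-- Conversely, **inside the disc `J(w) → ∞` only as `w → 0`**: if `g` takes values in the unit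
disc (eventually) and `J ∘ g → ∞`, then `g → 0`. [folklore] -/
theorem tendsto_zero_of_tendsto_negJoukowski {α : Type*} {l : Filter α} {g : α → ℂ}
    (hg : ∀ᶠ a in l, g a ∈ ball (0 : ℂ) 1)
    (h : Tendsto (fun a ↦ -(g a + (g a)⁻¹)) l (cocompact ℂ)) : Tendsto g l (𝓝 0) := by
  rw [← cobounded_eq_cocompact, ← tendsto_norm_atTop_iff_cobounded] at h
  -- `‖g‖⁻¹ ≥ ‖J ∘ g‖ - 1 → ∞`
  have h1 : Tendsto (fun a ↦ ‖g a‖⁻¹) l atTop := by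
    refine tendsto_atTop_mono' l ?_ (tendsto_atTop_add_const_right _ (-1) h)
    filter_upwards [hg] with a ha
    have hlt : ‖g a‖ < 1 := mem_ball_zero_iff.1 ha
    have := norm_negJoukowski_le (g a)
    linarith
  rw [tendsto_zero_iff_norm_tendsto_zero]
  have h2 : Tendsto (fun a ↦ (‖g a‖⁻¹)⁻¹) l (𝓝 0) := h1.inv_tendsto_atTop
  simpa only [inv_inv] using h2

end Complex
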